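/-
Copyright (c) 2026 the pub-hodgecm-mathlib formalisation cell (harness21).  Prover seat hodgecm-mathlib-F0P3a-p08 (g19): «S3-ram» seeding wave (LEAD F0P3a-plan (g12), owner
F0P3a-p06 (g15)), row (e2)(b) «[T2-c]-ram» (A-p19 (g26) PLAN-T2c-ram-layer3, inherited 22:13:38Z), LAYER 3 brick (ii-d): the FIXED-SIDE UNIT INDEX `[(Λ^⋆)^× : R^{⋆×}]`; 2026-09-01.
-/
import Literature.NumberTheory.Automorphic.TypeTwoOrderFixedIndexRamifiedBase        -- ★ (this seat) (ii-c): `relIndex_fixed_eq_pow_typeA∕B`, `natCard_residueField_eq_of_ramified_coord`, `star_mem_range_eval₂_iff`; brings ★ p847012, ★ p846557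
import Literature.NumberTheory.Automorphic.QuadraticRamifiedOrderNormIndex         -- ★ C3 p846601 (A-p19): `mem_eqLocus_prodMap_iff`, `prodMap_subtype_injective`, `exists_coord_fixed`, `comp_mem_eqLocus` (generic parts of the fixed-side model)
import Literature.NumberTheory.Automorphic.QuadraticUnramifiedOrderMonogenic       -- ★ p846912 (A-p19): `isUnit_fst_iff_isUnit_of_mem_range_of_nonsquare`, `exists_mul_eq_one_mem_range_of_nonsquare`; brings ★ p846900 `index_range_units_map_prod_mul_sq_eq`
import HarnessLib

/-!
# The type-(2) order at a TAMELY RAMIFIED base: the fixed-side model `Λ^⋆ ≅ 𝒪_F × O₁^{σ₁}`, `R^⋆` local with residue field `𝓀_F`, and `[(Λ^⋆)^× : R^{⋆×}]`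
# (Neukirch I §12; Serre, *Local Fields* Ch. I §6, Ch. V §2–§3; Rogawski 1990 §4.9)

Topic `NumberTheory/Automorphic`; namespace `Literature.NumberTheory.Automorphic`.  THEOREMS ONLY (no definition, no instance, no notation, no named fact, no `sorry`); (D0)
currency of ★ p846912 ∕ p847012 ∕ (ii-c).  Cell `pub/hodgecm-mathlib` (D-0151), crux H413 = `stmt-HodgeConjecture-24833`; «S3-ram» row (e2)(b) «[T2-c]-ram» LAYER 3, PLAN step
(ii-d) — the ramified-base twin of ★ C3 §3 (`isLocalRing_comap_fixed`, `natCard_residueField_comap_fixed`, `index_units_comap_fixed_eq`, `relIndex_units_fixed_eq`): the fixed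
ring `Λ^⋆` of `Λ = 𝒪_E × O₁` is the range of `Ψ₀ = (ιO, incl) : 𝒪_F × O₁^{σ₁} → Λ` (★ C3 `mem_eqLocus_prodMap_iff`), `R^⋆ = R.comap Ψ₀` is LOCAL with residue field `𝓀_F`
(units read on the first coordinate, ★ p846912), contains `(k₀^m, j′k₀^m)·(𝒪_F × O₁^{σ₁})` for `m = N + n` (`k₀` the uniformiser of `F` below `Π² = ιO k₀`, ★ p846557
`pow_mul_mem_range_eval₂`), and the second factor `O₁^{σ₁}` is a coordinate model over `𝒪_F`:  TYPE A (`σ₁θ = θ`): `O₁^{σ₁} = j′𝒪_F ⊕ j′𝒪_F·θ`, `θ² = j′ε₀` UNRAMIFIED (★ C3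
`exists_coord_fixed`) ⇒ ★ p846900 `index_range_units_map_prod_mul_sq_eq`: `[(Λ^⋆)^× : R^{⋆×}]·q² = (q²−1)·[Λ^⋆ : R^⋆] = (q²−1)·q^{(m+1)∕2}`;  TYPE B (`σ₁θ = −θ`):
`O₁^{σ₁} = j′𝒪_F ⊕ j′𝒪_F·(jΠ·θ)`, `(jΠ·θ)² = j′(k₀ε₀) ∈ j′𝔪_F` RAMIFIED (§1) ⇒ ★ C1 `index_range_units_map_prod_mul_eq`: `[(Λ^⋆)^× : R^{⋆×}]·q = (q−1)·q^{m∕2}`.  Transported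
into `Λ^×` along `Units.map Ψ₀` (★ C3 pattern): **`[G : V ⊓ G]·q² = (q²−1)·q^{(N+n+1)∕2}` (type A), `[G : V ⊓ G]·q = (q−1)·q^{(N+n)∕2}` (type B)**, `G` = `⋆`-fixed units, `V = R^×`.
HONEST LABEL: HC_CM is proved only modulo the 2 remaining named inputs (hLiu418 24832, h413 24833) until rung 0 closes; unconditional commutative algebra, count-neutral.

* §1 `mul_theta_mem_eqLocus_typeB`, `exists_coord_fixed_typeB` (the type-B fixed-side coordinate model).
* §2 `isLocalRing_comap_fixed_of_nonsquare`, `natCard_residueField_comap_fixed_of_nonsquare`, `pow_mul_mem_comap_fixed` (the conductor), `index_comap_fixed_eq_relIndex`.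
* §3 **`relIndex_units_fixed_mul_sq_eq_typeA`**, **`relIndex_units_fixed_mul_eq_typeB`** (`[G : V ⊓ G]` inside `Λ^×`).

## References
* [Neukirch1999] J. Neukirch, *Algebraic Number Theory*, Grundlehren 322 (1999): Ch. I §12 (orders, conductors, unit indices).
* [SerreLocalFields1979] J.-P. Serre, *Local Fields*, GTM 67 (1979): Ch. I §6 Prop. 15–18; Ch. V §2–§3.
* [Rogawski1990] J. D. Rogawski, *Automorphic Representations of Unitary Groups in Three Variables* (1990): §4.9 Lemma 4.9.3 p. 56.
-/

set_option autoImplicit false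

noncomputable section

open scoped ValuativeRel
open Polynomial ValuativeRel

namespace Literature.NumberTheory.Automorphic

variable {F E : Type*} [Field F] [ValuativeRel F] [Field E] [ValuativeRel E] {O₁ : Type*} [CommRing O₁]
  (ιO : 𝒪[F] →+* 𝒪[E]) (σO : 𝒪[E] →+* 𝒪[E]) (j : 𝒪[E] →+* O₁) (σ₁ : O₁ →+* O₁) (θ : O₁) {k₀ : 𝒪[E]}
  (u : 𝒪[E]) {t y D e₂ : 𝒪[E]} {lam : O₁} {ϖ : E} {n N : ℕ} {ϖO : 𝒪[E]} {k₀F ε₀ : 𝒪[F]} {ϖF : F}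

/-! ## §1 The type-B fixed-side coordinate model `O₁^{σ₁} = j′𝒪_F ⊕ j′𝒪_F·(jΠ·θ)` -/

/-- In type B (`σ₁θ = −θ`, `σΠ = −Π`) the element `jΠ·θ` is `σ₁`-fixed. [cite: SerreLocalFields1979, Ch. I §6 Prop. 18] -/
theorem mul_theta_mem_eqLocus_typeB (hσ₁j : ∀ a, σ₁ (j a) = j (σO a)) (hσ₁θ : σ₁ θ = -θ) (hσϖO : σO ϖO = -ϖO) :
    j ϖO * θ ∈ RingHom.eqLocus σ₁ (RingHom.id O₁) := by
  rw [RingHom.mem_eqLocus, map_mul, hσ₁j, hσϖO, hσ₁θ, map_neg]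
  change -j ϖO * -θ = j ϖO * θ
  ring

/-- **TYPE B: COORDINATES ON THE FIXED RING `O₁^{σ₁} = j′𝒪_F ⊕ j′𝒪_F·(jΠ·θ)`** (`j′ = j ∘ ιO` co-restricted): a `σ₁`-fixed `z = ja + jbθ` has `σa = a`, `σb = −b`, i.e. `a = ιO c`,
`b = ιO d·Π` (★ p846944). [cite: SerreLocalFields1979, Ch. I §6 Prop. 18] -/
theorem exists_coord_fixed_typeB (hcoord : ∀ z : O₁, ∃! bc : 𝒪[E] × 𝒪[E], z = j bc.1 + j bc.2 * θ)
    (hcoordE : ∀ a : 𝒪[E], ∃! bc : 𝒪[F] × 𝒪[F], a = ιO bc.1 + ιO bc.2 * ϖO) (hσι : ∀ b, σO (ιO b) = ιO b) (hσϖO : σO ϖO = -ϖO)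
    (h2F : ∀ b : 𝒪[F], b * 2 = 0 → b = 0) (hσ₁j : ∀ a, σ₁ (j a) = j (σO a)) (hσ₁θ : σ₁ θ = -θ) (hϖO0 : ∀ z : 𝒪[E], ϖO * z = 0 → z = 0)
    (hj' : ∀ y : 𝒪[F], (j.comp ιO) y ∈ RingHom.eqLocus σ₁ (RingHom.id O₁)) (hθ' : j ϖO * θ ∈ RingHom.eqLocus σ₁ (RingHom.id O₁)) :
    ∀ z : RingHom.eqLocus σ₁ (RingHom.id O₁), ∃! bc : 𝒪[F] × 𝒪[F],
      z = ((j.comp ιO).codRestrict (RingHom.eqLocus σ₁ (RingHom.id O₁)) hj') bc.1 +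
        ((j.comp ιO).codRestrict (RingHom.eqLocus σ₁ (RingHom.id O₁)) hj') bc.2 * ⟨j ϖO * θ, hθ'⟩ := by
  have hfixE := map_eq_self_iff_of_coord ιO ϖO hcoordE σO hσι hσϖO h2F
  have hantiE := map_add_self_eq_zero_iff_of_coord ιO ϖO hcoordE σO hσι hσϖO h2F
  have hιinj : Function.Injective ιO := fun b b' hbb => (coord_unique ιO ϖO hcoordE (by rw [hbb] : ιO b + ιO 0 * ϖO = ιO b' + ιO 0 * ϖO)).1
  intro z
  obtain ⟨⟨a, b⟩, hz, -⟩ := hcoord (z : O₁)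
  simp only at hz
  have hfix : σ₁ (z : O₁) = z := z.2
  obtain ⟨ha, hb⟩ := (fixed_anti_iff_typeB σO j θ hcoord σ₁ hσ₁j hσ₁θ a b).1.1 (by rw [← hz]; exact hfix)
  obtain ⟨c, rfl⟩ := (hfixE a).1 ha
  obtain ⟨d, rfl⟩ := (hantiE b).1 hb
  refine ⟨(c, d), Subtype.ext ?_, ?_⟩
  · simp only [Subring.coe_add, Subring.coe_mul, RingHom.codRestrict_apply, RingHom.coe_comp, Function.comp_apply]
    rw [hz, map_mul]; ring
  · rintro ⟨c', d'⟩ h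
    have h' := congrArg Subtype.val h
    simp only [Subring.coe_add, Subring.coe_mul, RingHom.codRestrict_apply, RingHom.coe_comp, Function.comp_apply] at h'
    rw [hz] at h'
    have h'' : j (ιO c) + j (ιO d * ϖO) * θ = j (ιO c') + j (ιO d' * ϖO) * θ := by rw [h', map_mul]; ring
    obtain ⟨h1, h2⟩ := coord_unique j θ hcoord h''
    have hdd : ιO d = ιO d' := by
      have h0 : ϖO * (ιO d - ιO d') = 0 := by rw [mul_sub, mul_comm ϖO, mul_comm ϖO, h2, sub_self]
      exact sub_eq_zero.1 (hϖO0 _ h0)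
    exact Prod.ext (hιinj h1).symm (hιinj hdd).symm

/-! ## §2 `R^⋆ = R.comap Ψ₀`: local, residue field `𝓀_F`, conductor, additive index -/

section FixedSide

variable (hθ : θ ^ 2 = j k₀) (hns : ∀ b : 𝒪[E], IsUnit (b * b - k₀)) (hcoord : ∀ z : O₁, ∃! bc : 𝒪[E] × 𝒪[E], z = j bc.1 + j bc.2 * θ)
  (h2 : e₂ * 2 = 1) (hD : 4 * D = t * t - y * y * k₀) (hlam : lam = j (e₂ * t) + j (e₂ * y) * θ)
  (hu1 : u - 1 ∈ IsLocalRing.maximalIdeal 𝒪[E]) (ht2 : t - 2 ∈ IsLocalRing.maximalIdeal 𝒪[E]) (hy : y ∈ IsLocalRing.maximalIdeal 𝒪[E])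
  (hσσ : ∀ a, σO (σO a) = a) (hσ₁σ₁ : ∀ z, σ₁ (σ₁ z) = z) (hσι : ∀ b, σO (ιO b) = ιO b) (hfixO : ∀ x, σO x = x → ∃ b, ιO b = x)
  (hιinj : Function.Injective ιO) (hσ₁j : ∀ a, σ₁ (j a) = j (σO a))

include hθ hns hcoord h2 hD hlam hu1 ht2 hy hσσ hσ₁σ₁ hσι hfixO hιinj in
/-- **`R^⋆ = R ∩ Λ^⋆` (pulled back along `Ψ₀ = (ιO, incl)`) IS LOCAL**, its units detected by the first (`𝒪_F`-) coordinate (★ p846912: units of `R` are read on the first coordinate,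
`R` is inverse-closed; the inverse of a fixed unit is fixed).  Unramified-`O₁` twin of ★ C3 `isLocalRing_comap_fixed` (whose hypotheses need `θ² ∈ 𝔪`; the conjuncts are
stated units-first to keep the two declarations apart). [cite: Neukirch1999, Ch. I §12] -/
theorem isLocalRing_comap_fixed_of_nonsquare :
    (∀ r : (Polynomial.eval₂RingHom (RingHom.prod (RingHom.id 𝒪[E]) j) ((u, lam) : 𝒪[E] × O₁)).range.comap
      (RingHom.prodMap ιO (RingHom.eqLocus σ₁ (RingHom.id O₁)).subtype), IsUnit r ↔ IsUnit (r : 𝒪[F] × RingHom.eqLocus σ₁ (RingHom.id O₁)).1) ∧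
    IsLocalRing ((Polynomial.eval₂RingHom (RingHom.prod (RingHom.id 𝒪[E]) j) ((u, lam) : 𝒪[E] × O₁)).range.comap
      (RingHom.prodMap ιO (RingHom.eqLocus σ₁ (RingHom.id O₁)).subtype)) := by
  set R := (Polynomial.eval₂RingHom (RingHom.prod (RingHom.id 𝒪[E]) j) ((u, lam) : 𝒪[E] × O₁)).range with hR
  set Ψ₀ := RingHom.prodMap ιO (RingHom.eqLocus σ₁ (RingHom.id O₁)).subtype with hΨ₀
  set R₀ := R.comap Ψ₀ with hR₀
  have hstar : ∀ z : 𝒪[E] × O₁, RingHom.prodMap σO σ₁ (RingHom.prodMap σO σ₁ z) = z := star_inv_gen σO σ₁ hσσ hσ₁σ₁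
  have hunit : ∀ r : R₀, IsUnit r ↔ IsUnit (r : 𝒪[F] × RingHom.eqLocus σ₁ (RingHom.id O₁)).1 := by
    intro r
    constructor
    · intro h
      exact (Prod.isUnit_iff.1 (h.map R₀.subtype)).1
    · intro h1
      have hmem : Ψ₀ (r : 𝒪[F] × _) ∈ R := r.2
      have hfst : IsUnit (Ψ₀ (r : 𝒪[F] × _)).1 := h1.map ιO
      have hzu : IsUnit (Ψ₀ (r : 𝒪[F] × _)) := (isUnit_fst_iff_isUnit_of_mem_range_of_nonsquare j θ hθ hns hcoord u h2 hD hlam hu1 ht2 hy hmem).1 hfst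
      obtain ⟨z', hz'R, hzz'⟩ := exists_mul_eq_one_mem_range_of_nonsquare j θ hθ hns hcoord u hzu hmem
      -- the inverse `z'` is fixed (uniqueness of inverses), hence in the range of `Ψ₀`
      have hfixz : RingHom.prodMap σO σ₁ (Ψ₀ (r : 𝒪[F] × _)) = Ψ₀ (r : 𝒪[F] × _) :=
        (mem_eqLocus_prodMap_iff ιO σO σ₁ hσι hfixO _).2 ⟨_, rfl⟩
      have hfixz' : RingHom.prodMap σO σ₁ z' = z' := by
        have h := congrArg (RingHom.prodMap σO σ₁) hzz'
        rw [map_mul, map_one, hfixz] at h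
        -- `z'` and `⋆z'` are both inverses of `Ψ₀ r`
        calc RingHom.prodMap σO σ₁ z' = RingHom.prodMap σO σ₁ z' * (Ψ₀ (r : 𝒪[F] × _) * z') := by rw [hzz', mul_one]
          _ = (Ψ₀ (r : 𝒪[F] × _) * RingHom.prodMap σO σ₁ z') * z' := by ring
          _ = z' := by rw [h, one_mul]
      obtain ⟨s, hs⟩ := (mem_eqLocus_prodMap_iff ιO σO σ₁ hσι hfixO _).1 (RingHom.mem_eqLocus.2 hfixz')
      have hsR : s ∈ R₀ := by change Ψ₀ s ∈ R; rw [hs]; exact hz'R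
      refine IsUnit.of_mul_eq_one ⟨s, hsR⟩ (Subtype.ext (prodMap_subtype_injective ιO σ₁ hιinj ?_))
      change Ψ₀ ((r : 𝒪[F] × _) * s) = Ψ₀ 1
      rw [map_mul, map_one, hs, hzz']
  refine ⟨hunit, ?_⟩
  haveI : Nontrivial R₀ := by
    refine ⟨⟨0, 1, fun h => ?_⟩⟩
    have := congrArg (fun r : R₀ => (r : 𝒪[F] × RingHom.eqLocus σ₁ (RingHom.id O₁)).1) h
    simp at this
  refine IsLocalRing.of_nonunits_add ?_
  intro a b ha hb
  rw [mem_nonunits_iff, hunit] at ha hb ⊢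
  rw [Subring.coe_add, Prod.fst_add]
  intro hab
  have ham : (a : 𝒪[F] × RingHom.eqLocus σ₁ (RingHom.id O₁)).1 ∈ IsLocalRing.maximalIdeal 𝒪[F] := (IsLocalRing.mem_maximalIdeal _).2 ha
  have hbm : (b : 𝒪[F] × RingHom.eqLocus σ₁ (RingHom.id O₁)).1 ∈ IsLocalRing.maximalIdeal 𝒪[F] := (IsLocalRing.mem_maximalIdeal _).2 hb
  exact (IsLocalRing.mem_maximalIdeal _ |>.1 (Ideal.add_mem _ ham hbm)) hab

include hθ hns hcoord h2 hD hlam hu1 ht2 hy hσσ hσ₁σ₁ hσι hfixO hιinj hσ₁j in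
/-- **THE RESIDUE FIELD OF `R^⋆` IS `𝓀_F`**: `#k_{R^⋆} = q` (the residue of the first coordinate is onto `𝓀_F` — constants `(ιO c, jιO c) ∈ R^⋆` — with kernel the non-units).
Twin of ★ C3 `natCard_residueField_comap_fixed`. [cite: Neukirch1999, Ch. I §12] -/
theorem natCard_residueField_comap_fixed_of_nonsquare :
    @Nat.card (@IsLocalRing.ResidueField ((Polynomial.eval₂RingHom (RingHom.prod (RingHom.id 𝒪[E]) j) ((u, lam) : 𝒪[E] × O₁)).range.comap
      (RingHom.prodMap ιO (RingHom.eqLocus σ₁ (RingHom.id O₁)).subtype)) _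
      (isLocalRing_comap_fixed_of_nonsquare ιO σO j σ₁ θ u hθ hns hcoord h2 hD hlam hu1 ht2 hy hσσ hσ₁σ₁ hσι hfixO hιinj).2) = Nat.card 𝓀[F] := by
  set R := (Polynomial.eval₂RingHom (RingHom.prod (RingHom.id 𝒪[E]) j) ((u, lam) : 𝒪[E] × O₁)).range with hR
  set Ψ₀ := RingHom.prodMap ιO (RingHom.eqLocus σ₁ (RingHom.id O₁)).subtype with hΨ₀
  set R₀ := R.comap Ψ₀ with hR₀
  obtain ⟨hunit, hloc⟩ := isLocalRing_comap_fixed_of_nonsquare ιO σO j σ₁ θ u hθ hns hcoord h2 hD hlam hu1 ht2 hy hσσ hσ₁σ₁ hσι hfixO hιinj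
  letI := hloc
  have hj' : ∀ y : 𝒪[F], (j.comp ιO) y ∈ RingHom.eqLocus σ₁ (RingHom.id O₁) := fun y => by
    rw [RingHom.mem_eqLocus, RingHom.coe_comp, Function.comp_apply, hσ₁j, hσι]; rfl
  set χ : R₀ →+* 𝓀[F] := (IsLocalRing.residue 𝒪[F]).comp ((RingHom.fst 𝒪[F] (RingHom.eqLocus σ₁ (RingHom.id O₁))).comp R₀.subtype) with hχ
  have hχapp : ∀ r : R₀, χ r = IsLocalRing.residue 𝒪[F] (r : 𝒪[F] × RingHom.eqLocus σ₁ (RingHom.id O₁)).1 := fun _ => rfl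
  have hsurj : Function.Surjective χ := by
    intro x
    obtain ⟨c, rfl⟩ := IsLocalRing.residue_surjective x
    have hmem : ((c, ((j.comp ιO).codRestrict (RingHom.eqLocus σ₁ (RingHom.id O₁)) hj') c) : 𝒪[F] × RingHom.eqLocus σ₁ (RingHom.id O₁)) ∈ R₀ := by
      change Ψ₀ _ ∈ R
      exact const_mem_range_eval₂ j u (ιO c)
    exact ⟨⟨_, hmem⟩, rfl⟩
  have hker : RingHom.ker χ = IsLocalRing.maximalIdeal R₀ := by
    ext r
    rw [RingHom.mem_ker, hχapp, IsLocalRing.residue_eq_zero_iff, IsLocalRing.mem_maximalIdeal, IsLocalRing.mem_maximalIdeal, mem_nonunits_iff,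
      mem_nonunits_iff, hunit]
  unfold IsLocalRing.ResidueField
  rw [← hker]
  exact Nat.card_congr (RingHom.quotientKerEquivOfSurjective hsurj).toEquiv

variable (hϖ : IsUniformizingElement ϖ)
  (hn : valuation E ((u * u - t * u + D : 𝒪[E]) : E) = valuation E ϖ ^ n) (hN : valuation E ((y : 𝒪[E]) : E) = valuation E ϖ ^ N)
  (hcoordE : ∀ a : 𝒪[E], ∃! bc : 𝒪[F] × 𝒪[F], a = ιO bc.1 + ιO bc.2 * ϖO)
  (hϖOu : IsUniformizingElement (ϖO : E)) (hϖOsq : ϖO * ϖO = ιO k₀F) [IsDiscreteValuationRing 𝒪[E]]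

omit [IsDiscreteValuationRing 𝒪[E]] in
include hθ hcoord h2 hD hlam hn hN hϖOu hϖOsq in
/-- **THE CONDUCTOR ON THE FIXED SIDE**: `(k₀^m, j′k₀^m)·x ∈ R^⋆` for every `x ∈ 𝒪_F × O₁^{σ₁}`, `m = N + n` (`ιO k₀^m = Π^{2m} = Π^m·Π^m` and ★ p846557 `pow_mul_mem_range_eval₂`:
`Π^m·Λ ⊆ R`, `Π` a uniformiser of `E` of the same valuation as `ϖ`). [cite: Neukirch1999, Ch. I §12] -/
theorem pow_mul_mem_comap_fixed (hϖOv : valuation E ((ϖO : 𝒪[E]) : E) = valuation E ϖ)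
    (hj' : ∀ y : 𝒪[F], (j.comp ιO) y ∈ RingHom.eqLocus σ₁ (RingHom.id O₁)) (x : 𝒪[F] × RingHom.eqLocus σ₁ (RingHom.id O₁)) :
    ((k₀F ^ (N + n), ((j.comp ιO).codRestrict (RingHom.eqLocus σ₁ (RingHom.id O₁)) hj') (k₀F ^ (N + n))) : 𝒪[F] × RingHom.eqLocus σ₁ (RingHom.id O₁)) * x ∈
      (Polynomial.eval₂RingHom (RingHom.prod (RingHom.id 𝒪[E]) j) ((u, lam) : 𝒪[E] × O₁)).range.comap
        (RingHom.prodMap ιO (RingHom.eqLocus σ₁ (RingHom.id O₁)).subtype) := by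
  set R := (Polynomial.eval₂RingHom (RingHom.prod (RingHom.id 𝒪[E]) j) ((u, lam) : 𝒪[E] × O₁)).range with hR
  set Ψ₀ := RingHom.prodMap ιO (RingHom.eqLocus σ₁ (RingHom.id O₁)).subtype with hΨ₀
  -- the valuations rephrased for the uniformiser `Π`
  have hn' : valuation E ((u * u - t * u + D : 𝒪[E]) : E) = valuation E (ϖO : E) ^ n := by rw [hϖOv]; exact hn
  have hN' : valuation E ((y : 𝒪[E]) : E) = valuation E (ϖO : E) ^ N := by rw [hϖOv]; exact hN
  have hϖOeq : (⟨(ϖO : E), hϖOu.mem⟩ : 𝒪[E]) = ϖO := rfl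
  have hcond : ∀ z : 𝒪[E] × O₁, ((ϖO ^ (N + n), j (ϖO ^ (N + n))) : 𝒪[E] × O₁) * z ∈ R := fun z => by
    have h := pow_mul_mem_range_eval₂ j θ hθ hcoord u h2 hD hlam hϖOu hn' hN' z
    rw [hϖOeq] at h
    exact h
  change Ψ₀ _ ∈ R
  rw [map_mul]
  have hΨ : Ψ₀ ((k₀F ^ (N + n), ((j.comp ιO).codRestrict (RingHom.eqLocus σ₁ (RingHom.id O₁)) hj') (k₀F ^ (N + n))))
      = ((ϖO ^ (N + n), j (ϖO ^ (N + n))) : 𝒪[E] × O₁) * ((ϖO ^ (N + n), j (ϖO ^ (N + n))) : 𝒪[E] × O₁) := by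
    have hk : ιO (k₀F ^ (N + n)) = ϖO ^ (N + n) * ϖO ^ (N + n) := by rw [map_pow, ← hϖOsq, ← mul_pow]
    refine Prod.ext ?_ ?_
    · change ιO (k₀F ^ (N + n)) = ϖO ^ (N + n) * ϖO ^ (N + n)
      exact hk
    · change ((j.comp ιO) (k₀F ^ (N + n)) : O₁) = j (ϖO ^ (N + n)) * j (ϖO ^ (N + n))
      rw [RingHom.comp_apply, hk, map_mul]
  rw [hΨ, mul_assoc]
  exact hcond _

omit [IsDiscreteValuationRing 𝒪[E]] in
include hσι hfixO in
/-- **`[𝒪_F × O₁^{σ₁} : R^⋆] = [Λ^⋆ : R ∩ Λ^⋆]`**: the fixed-side model has the additive index of ★ (ii-c) (`Ψ₀` maps onto `Λ^⋆`; Mathlib `AddSubgroup.index_comap`).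
[cite: Neukirch1999, Ch. I §12] -/
theorem index_comap_fixed_eq_relIndex :
    ((Polynomial.eval₂RingHom (RingHom.prod (RingHom.id 𝒪[E]) j) ((u, lam) : 𝒪[E] × O₁)).range.comap
        (RingHom.prodMap ιO (RingHom.eqLocus σ₁ (RingHom.id O₁)).subtype)).toAddSubgroup.index =
      (Polynomial.eval₂RingHom (RingHom.prod (RingHom.id 𝒪[E]) j) ((u, lam) : 𝒪[E] × O₁)).range.toAddSubgroup.relIndex
        (RingHom.eqLocus (RingHom.prodMap σO σ₁) (RingHom.id (𝒪[E] × O₁))).toAddSubgroup := by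
  set R := (Polynomial.eval₂RingHom (RingHom.prod (RingHom.id 𝒪[E]) j) ((u, lam) : 𝒪[E] × O₁)).range with hR
  set Ψ₀ := RingHom.prodMap ιO (RingHom.eqLocus σ₁ (RingHom.id O₁)).subtype with hΨ₀
  have hrange : Ψ₀.toAddMonoidHom.range = (RingHom.eqLocus (RingHom.prodMap σO σ₁) (RingHom.id (𝒪[E] × O₁))).toAddSubgroup := by
    ext z
    rw [AddMonoidHom.mem_range, Subring.mem_toAddSubgroup, mem_eqLocus_prodMap_iff ιO σO σ₁ hσι hfixO]
    rfl
  have hcomap : (R.comap Ψ₀).toAddSubgroup = R.toAddSubgroup.comap Ψ₀.toAddMonoidHom := rfl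
  rw [hcomap, AddSubgroup.index_comap, hrange]

/-! ## §3 The fixed unit index `[G : V ⊓ G]` inside `Λ^×` -/

omit [IsDiscreteValuationRing 𝒪[E]] in
include hσι hfixO hιinj in
/-- **TRANSPORT INTO `Λ^×`**: `[G : V ⊓ G] = [(𝒪_F × O₁^{σ₁})^× : (R^⋆)^×]` (`G` the `⋆`-fixed units = `range (Units.map Ψ₀)`, `V = R^×` pulls back to `(R^⋆)^×`; ★ C3 pattern,
Mathlib `Subgroup.index_comap`). [cite: Neukirch1999, Ch. I §12] -/
theorem relIndex_units_fixed_eq_index_comap :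
    (Units.map ((Polynomial.eval₂RingHom (RingHom.prod (RingHom.id 𝒪[E]) j) ((u, lam) : 𝒪[E] × O₁)).range.subtype :
        (Polynomial.eval₂RingHom (RingHom.prod (RingHom.id 𝒪[E]) j) ((u, lam) : 𝒪[E] × O₁)).range →* 𝒪[E] × O₁)).range.relIndex
      (RingHom.eqLocus (RingHom.prodMap σO σ₁) (RingHom.id (𝒪[E] × O₁))).toSubmonoid.units =
    (Units.map (((Polynomial.eval₂RingHom (RingHom.prod (RingHom.id 𝒪[E]) j) ((u, lam) : 𝒪[E] × O₁)).range.comap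
        (RingHom.prodMap ιO (RingHom.eqLocus σ₁ (RingHom.id O₁)).subtype)).subtype :
        ((Polynomial.eval₂RingHom (RingHom.prod (RingHom.id 𝒪[E]) j) ((u, lam) : 𝒪[E] × O₁)).range.comap
          (RingHom.prodMap ιO (RingHom.eqLocus σ₁ (RingHom.id O₁)).subtype)) →* 𝒪[F] × RingHom.eqLocus σ₁ (RingHom.id O₁))).range.index := by
  set R := (Polynomial.eval₂RingHom (RingHom.prod (RingHom.id 𝒪[E]) j) ((u, lam) : 𝒪[E] × O₁)).range with hR
  set Ψ₀ := RingHom.prodMap ιO (RingHom.eqLocus σ₁ (RingHom.id O₁)).subtype with hΨ₀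
  set R₀ := R.comap Ψ₀ with hR₀
  set B₀ := RingHom.eqLocus (RingHom.prodMap σO σ₁) (RingHom.id (𝒪[E] × O₁)) with hB₀
  set V := (Units.map (R.subtype : R →* 𝒪[E] × O₁)).range with hV
  set Φ₀ : (𝒪[F] × RingHom.eqLocus σ₁ (RingHom.id O₁))ˣ →* (𝒪[E] × O₁)ˣ := Units.map (Ψ₀ : _ →* 𝒪[E] × O₁) with hΦ₀
  have hinj := prodMap_subtype_injective ιO σ₁ hιinj
  have hrange : Φ₀.range = B₀.toSubmonoid.units := by
    ext w
    rw [Submonoid.mem_units_iff, MonoidHom.mem_range]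
    constructor
    · rintro ⟨w₀, rfl⟩
      refine ⟨(mem_eqLocus_prodMap_iff ιO σO σ₁ hσι hfixO _).2 ⟨(w₀ : 𝒪[F] × _), rfl⟩, (mem_eqLocus_prodMap_iff ιO σO σ₁ hσι hfixO _).2 ⟨(↑w₀⁻¹ : 𝒪[F] × _), ?_⟩⟩
      rw [hΦ₀, Units.coe_map_inv]; rfl
    · rintro ⟨h1, h2⟩
      obtain ⟨p, hp⟩ := (mem_eqLocus_prodMap_iff ιO σO σ₁ hσι hfixO _).1 h1
      obtain ⟨p', hp'⟩ := (mem_eqLocus_prodMap_iff ιO σO σ₁ hσι hfixO _).1 h2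
      have hpp : p * p' = 1 := hinj (by rw [map_mul, map_one]; change Ψ₀ p * Ψ₀ p' = 1; rw [hp, hp', Units.mul_inv])
      have hp'p : p' * p = 1 := by rw [mul_comm]; exact hpp
      exact ⟨⟨p, p', hpp, hp'p⟩, Units.ext hp⟩
  have hcomap : V.comap Φ₀ = (Units.map (R₀.subtype : R₀ →* 𝒪[F] × RingHom.eqLocus σ₁ (RingHom.id O₁))).range := by
    ext w₀
    rw [Subgroup.mem_comap, hV, mem_range_units_map_subtype_iff, mem_range_units_map_subtype_iff, hΦ₀, Units.coe_map, Units.coe_map_inv]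
    rfl
  have hidx := Subgroup.index_comap V Φ₀
  rw [hrange, hcomap] at hidx
  exact hidx.symm

variable [Finite 𝓀[F]] (hx1 : ((u, lam) : 𝒪[E] × O₁) * RingHom.prodMap σO σ₁ (u, lam) = 1) (huD : IsUnit (u * D))
  (hσϖO : σO ϖO = -ϖO) (h2F : ∀ b : 𝒪[F], b * 2 = 0 → b = 0) (hϖF : IsUniformizingElement ϖF) (hk₀F : valuation F (k₀F : F) = valuation F ϖF)

include hθ hns hcoord h2 hD hlam hu1 ht2 hy hσσ hσ₁σ₁ hσι hfixO hιinj hσ₁j hϖ hn hN hcoordE hϖOu hϖOsq hx1 huD hσϖO h2F hϖF hk₀F in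
/-- **TYPE A (`σ₁θ = θ`): `[G : V ⊓ G] · q² = (q² − 1) · q^{(N+n+1)∕2}`** — the fixed-side model `𝒪_F × O₁^{σ₁}` has second factor the UNRAMIFIED coordinate model `j′𝒪_F ⊕ j′𝒪_F·θ`
(`θ² = j′ε₀`, ★ C3 `exists_coord_fixed`), `R^⋆` is local with `#k = q` and conductor `⊇ k₀^{N+n}`, so ★ p846900 `index_range_units_map_prod_mul_sq_eq` with `[Λ^⋆ : R^⋆] =
q^{(N+n+1)∕2}` (★ (ii-c), `N + n` odd).  CERT «[T2-c]-ram» §3 (A): `[(Λ^⋆)^× : (R^⋆)^×] = q^{(m−3)∕2}(q²−1)`. [cite: Neukirch1999, Ch. I §12] [cite: Rogawski1990, §4.9 Lemma 4.9.3 p. 56] -/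
theorem relIndex_units_fixed_mul_sq_eq_typeA (hϖOv : valuation E ((ϖO : 𝒪[E]) : E) = valuation E ϖ) (hσ₁θ : σ₁ θ = θ) (hm : Odd (N + n))
    (hε₀ : k₀ = ιO ε₀) (hnsF : ∀ b : 𝒪[F], IsUnit (b * b - ε₀)) (hNn : 1 ≤ N + n) :
    (Units.map ((Polynomial.eval₂RingHom (RingHom.prod (RingHom.id 𝒪[E]) j) ((u, lam) : 𝒪[E] × O₁)).range.subtype :
        (Polynomial.eval₂RingHom (RingHom.prod (RingHom.id 𝒪[E]) j) ((u, lam) : 𝒪[E] × O₁)).range →* 𝒪[E] × O₁)).range.relIndex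
      (RingHom.eqLocus (RingHom.prodMap σO σ₁) (RingHom.id (𝒪[E] × O₁))).toSubmonoid.units * Nat.card 𝓀[F] ^ 2 =
    (Nat.card 𝓀[F] ^ 2 - 1) * Nat.card 𝓀[F] ^ ((N + n + 1) / 2) := by
  set R := (Polynomial.eval₂RingHom (RingHom.prod (RingHom.id 𝒪[E]) j) ((u, lam) : 𝒪[E] × O₁)).range with hR
  set Ψ₀ := RingHom.prodMap ιO (RingHom.eqLocus σ₁ (RingHom.id O₁)).subtype with hΨ₀
  set R₀ := R.comap Ψ₀ with hR₀
  obtain ⟨-, hloc⟩ := isLocalRing_comap_fixed_of_nonsquare ιO σO j σ₁ θ u hθ hns hcoord h2 hD hlam hu1 ht2 hy hσσ hσ₁σ₁ hσι hfixO hιinj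
  letI := hloc
  obtain ⟨hj', hθ'⟩ := comp_mem_eqLocus ιO σO j σ₁ θ hσι hσ₁j hσ₁θ
  -- the fixed-side model data (type A: unramified over `𝒪_F`)
  have hθ'' : (⟨θ, hθ'⟩ : RingHom.eqLocus σ₁ (RingHom.id O₁)) ^ 2 = ((j.comp ιO).codRestrict (RingHom.eqLocus σ₁ (RingHom.id O₁)) hj') ε₀ :=
    Subtype.ext (by rw [RingHom.codRestrict_apply, RingHom.comp_apply, ← hε₀]; exact hθ)
  have hns' : ∀ b : 𝒪[F], IsUnit (b * b - ε₀) := hnsF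
  have hcoord' := exists_coord_fixed ιO σO j σ₁ θ hfixO hιinj hσ₁j hσ₁θ hcoord hj' hθ'
  have hres := natCard_residueField_comap_fixed_of_nonsquare ιO σO j σ₁ θ u hθ hns hcoord h2 hD hlam hu1 ht2 hy hσσ hσ₁σ₁ hσι hfixO hιinj hσ₁j
  -- `k₀F` is a uniformiser of `F`
  have hk₀u : IsUniformizingElement ((k₀F : 𝒪[F]) : F) :=
    ⟨k₀F.2, fun h0 => by
      have h' := hk₀F; rw [h0, map_zero] at h'; exact ((Valuation.ne_zero_iff _).2 hϖF.ne_zero) h'.symm,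
     by
      have e : (⟨((k₀F : 𝒪[F]) : F), k₀F.2⟩ : 𝒪[F]) = k₀F := rfl
      rw [e, span_singleton_eq_span_uniformizer_pow_of_valuation_eq hϖF (N := 1) (by rw [pow_one]; exact hk₀F), pow_one, hϖF.span_eq]⟩
  have hk₀eq : (⟨((k₀F : 𝒪[F]) : F), hk₀u.mem⟩ : 𝒪[F]) = k₀F := Subtype.ext rfl
  have hcond : ∀ x : 𝒪[F] × RingHom.eqLocus σ₁ (RingHom.id O₁),
      (((⟨((k₀F : 𝒪[F]) : F), hk₀u.mem⟩ : 𝒪[F]) ^ (N + n), ((j.comp ιO).codRestrict (RingHom.eqLocus σ₁ (RingHom.id O₁)) hj') ((⟨((k₀F : 𝒪[F]) : F), hk₀u.mem⟩ : 𝒪[F]) ^ (N + n))) :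
        𝒪[F] × RingHom.eqLocus σ₁ (RingHom.id O₁)) * x ∈ R₀ := fun x => by
    rw [hk₀eq]
    exact pow_mul_mem_comap_fixed ιO j σ₁ θ u hθ hcoord h2 hD hlam hn hN hϖOu hϖOsq hϖOv hj' x
  have key := index_range_units_map_prod_mul_sq_eq ((j.comp ιO).codRestrict (RingHom.eqLocus σ₁ (RingHom.id O₁)) hj') ⟨θ, hθ'⟩ hθ'' hns' hcoord' hk₀u
    (by omega : 0 < N + n) R₀ hres hcond
  rw [index_comap_fixed_eq_relIndex ιO σO j σ₁ u hσι hfixO,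
    relIndex_fixed_eq_pow_typeA ιO σO j σ₁ θ u hθ hcoord h2 hD hlam hϖ hn hN hσσ hσ₁σ₁ hσ₁j hx1 huD hcoordE hσι hσϖO h2F hϖOu hϖOsq hϖF hk₀F hϖOv hσ₁θ hm,
    ← relIndex_units_fixed_eq_index_comap ιO σO j σ₁ u hσι hfixO hιinj] at key
  exact key

include hθ hns hcoord h2 hD hlam hu1 ht2 hy hσσ hσ₁σ₁ hσι hfixO hιinj hσ₁j hϖ hn hN hcoordE hϖOu hϖOsq hx1 huD hσϖO h2F hϖF hk₀F in
/-- **TYPE B (`σ₁θ = −θ`): `[G : V ⊓ G] · q = (q − 1) · q^{(N+n)∕2}`** — the fixed-side model's second factor is the RAMIFIED coordinate model `j′𝒪_F ⊕ j′𝒪_F·(jΠ·θ)`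
(`(jΠ·θ)² = j′(k₀ε₀) ∈ j′𝔪_F`, §1), so ★ C1 `index_range_units_map_prod_mul_eq` with `[Λ^⋆ : R^⋆] = q^{(N+n)∕2}` (★ (ii-c), `N + n` even).  CERT §3 (B): `q^{(m−2)∕2}(q−1)`.
[cite: Neukirch1999, Ch. I §12] [cite: Rogawski1990, §4.9 Lemma 4.9.3 p. 56] -/
theorem relIndex_units_fixed_mul_eq_typeB (hϖOv : valuation E ((ϖO : 𝒪[E]) : E) = valuation E ϖ) (hσ₁θ : σ₁ θ = -θ) (hm : Even (N + n))
    (hε₀ : k₀ = ιO ε₀) (hNn : 1 ≤ N + n) :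
    (Units.map ((Polynomial.eval₂RingHom (RingHom.prod (RingHom.id 𝒪[E]) j) ((u, lam) : 𝒪[E] × O₁)).range.subtype :
        (Polynomial.eval₂RingHom (RingHom.prod (RingHom.id 𝒪[E]) j) ((u, lam) : 𝒪[E] × O₁)).range →* 𝒪[E] × O₁)).range.relIndex
      (RingHom.eqLocus (RingHom.prodMap σO σ₁) (RingHom.id (𝒪[E] × O₁))).toSubmonoid.units * Nat.card 𝓀[F] =
    (Nat.card 𝓀[F] - 1) * Nat.card 𝓀[F] ^ ((N + n) / 2) := by
  set R := (Polynomial.eval₂RingHom (RingHom.prod (RingHom.id 𝒪[E]) j) ((u, lam) : 𝒪[E] × O₁)).range with hR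
  set Ψ₀ := RingHom.prodMap ιO (RingHom.eqLocus σ₁ (RingHom.id O₁)).subtype with hΨ₀
  set R₀ := R.comap Ψ₀ with hR₀
  obtain ⟨-, hloc⟩ := isLocalRing_comap_fixed_of_nonsquare ιO σO j σ₁ θ u hθ hns hcoord h2 hD hlam hu1 ht2 hy hσσ hσ₁σ₁ hσι hfixO hιinj
  letI := hloc
  have hj' : ∀ y : 𝒪[F], (j.comp ιO) y ∈ RingHom.eqLocus σ₁ (RingHom.id O₁) := fun y => by
    rw [RingHom.mem_eqLocus, RingHom.coe_comp, Function.comp_apply, hσ₁j, hσι]; rfl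
  have hθ' : j ϖO * θ ∈ RingHom.eqLocus σ₁ (RingHom.id O₁) := mul_theta_mem_eqLocus_typeB σO j σ₁ θ hσ₁j hσ₁θ hσϖO
  have hϖO0 : ϖO ≠ 0 := by
    intro h0
    have h' := hϖOv
    rw [h0, ZeroMemClass.coe_zero, map_zero] at h'
    exact ((Valuation.ne_zero_iff _).2 hϖ.ne_zero) h'.symm
  have hreg : ∀ z : 𝒪[E], ϖO * z = 0 → z = 0 := fun z hz => mul_left_cancel₀ hϖO0 (by rw [hz, mul_zero])
  -- the fixed-side model data (type B: ramified over `𝒪_F`, `θ′ = jΠ·θ`, `θ′² = j′(k₀F·ε₀)`)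
  have hθ'' : (⟨j ϖO * θ, hθ'⟩ : RingHom.eqLocus σ₁ (RingHom.id O₁)) ^ 2 = ((j.comp ιO).codRestrict (RingHom.eqLocus σ₁ (RingHom.id O₁)) hj') (k₀F * ε₀) :=
    Subtype.ext (by
      change (j ϖO * θ) ^ 2 = j (ιO (k₀F * ε₀))
      rw [mul_pow, hθ, hε₀, map_mul, ← hϖOsq]; simp only [map_mul]; ring)
  have hkε : k₀F * ε₀ ∈ IsLocalRing.maximalIdeal 𝒪[F] := by
    refine Ideal.mul_mem_right _ _ ?_
    rw [IsLocalRing.mem_maximalIdeal, mem_nonunits_iff, Valuation.Integers.isUnit_iff_valuation_eq_one (Valuation.integer.integers (valuation F))]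
    change ¬ valuation F (k₀F : F) = 1
    rw [hk₀F]; exact hϖF.valuation_lt_one.ne
  have hcoord' := exists_coord_fixed_typeB ιO σO j σ₁ θ hcoord hcoordE hσι hσϖO h2F hσ₁j hσ₁θ hreg hj' hθ'
  have hres := natCard_residueField_comap_fixed_of_nonsquare ιO σO j σ₁ θ u hθ hns hcoord h2 hD hlam hu1 ht2 hy hσσ hσ₁σ₁ hσι hfixO hιinj hσ₁j
  have hk₀u : IsUniformizingElement ((k₀F : 𝒪[F]) : F) :=
    ⟨k₀F.2, fun h0 => by
      have h' := hk₀F; rw [h0, map_zero] at h'; exact ((Valuation.ne_zero_iff _).2 hϖF.ne_zero) h'.symm,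
     by
      have e : (⟨((k₀F : 𝒪[F]) : F), k₀F.2⟩ : 𝒪[F]) = k₀F := rfl
      rw [e, span_singleton_eq_span_uniformizer_pow_of_valuation_eq hϖF (N := 1) (by rw [pow_one]; exact hk₀F), pow_one, hϖF.span_eq]⟩
  have hk₀eq : (⟨((k₀F : 𝒪[F]) : F), hk₀u.mem⟩ : 𝒪[F]) = k₀F := Subtype.ext rfl
  have hcond : ∀ x : 𝒪[F] × RingHom.eqLocus σ₁ (RingHom.id O₁),
      (((⟨((k₀F : 𝒪[F]) : F), hk₀u.mem⟩ : 𝒪[F]) ^ (N + n), ((j.comp ιO).codRestrict (RingHom.eqLocus σ₁ (RingHom.id O₁)) hj') ((⟨((k₀F : 𝒪[F]) : F), hk₀u.mem⟩ : 𝒪[F]) ^ (N + n))) :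
        𝒪[F] × RingHom.eqLocus σ₁ (RingHom.id O₁)) * x ∈ R₀ := fun x => by
    rw [hk₀eq]
    exact pow_mul_mem_comap_fixed ιO j σ₁ θ u hθ hcoord h2 hD hlam hn hN hϖOu hϖOsq hϖOv hj' x
  have key := index_range_units_map_prod_mul_eq ((j.comp ιO).codRestrict (RingHom.eqLocus σ₁ (RingHom.id O₁)) hj') ⟨j ϖO * θ, hθ'⟩ hθ'' hkε hcoord' hk₀u
    (by omega : 0 < N + n) R₀ hres hcond
  rw [index_comap_fixed_eq_relIndex ιO σO j σ₁ u hσι hfixO,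
    relIndex_fixed_eq_pow_typeB ιO σO j σ₁ θ u hθ hcoord h2 hD hlam hϖ hn hN hσσ hσ₁σ₁ hσ₁j hx1 huD hcoordE hσι hσϖO h2F hϖOu hϖOsq hϖF hk₀F hϖOv hσ₁θ hm,
    ← relIndex_units_fixed_eq_index_comap ιO σO j σ₁ u hσι hfixO hιinj] at key
  exact key

end FixedSide

end Literature.NumberTheory.Automorphic

end
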